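import Summits.AtomisticToContinuum.HydrodynamicLimit.Theorems.RelayRaceLocalityLightConeInLawSketchLine
import Summits.AtomisticToContinuum.HydrodynamicLimit.Theorems.RelayRaceLocalityLightConeInLawStubTimeZero
import Literature.MathematicalPhysics.KineticTheory.HardSphereEulerProofs
import Literature.Analysis.FluidPDE.HardSphereRegularGeometry

/-!
# Vocabulary of the line `count-sufficiency-reduction` (crux `LightConeInLaw`, stmt-AtomisticToContinuum-12500)

Support file (`--supports stmt-AtomisticToContinuum-12500`, route `RelayRaceLocality`), lead c5, 2026-08-17:
verbatim from the planner's registered skeleton `Cruxes/LightConeInLaw/Lines/count_sufficiency_reduction.lean`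
(2026-08-16) — the line's LOCAL VOCABULARY and its proved bookkeeping, so that the registered stubs can land as
separate Theorems files importing one module (pattern of `…LightConeInLawSketchLine.lean` p96526, `…SVCLine.lean`
p122841): `ballCount` (particles in an open minimal-image ball) + measurability, `CountLLN` (ball-count law of
large numbers, a predicate), the crux observable `obsF`
+ `measurable_obsF`, and the small tools `integral_eq_one_of_llnAt`, `canonicalDensity_const_mul` (the abstract mixture lemma of the
composition is the sibling file `…CSRMixture.lean`; `sigma_eq_of_global_agreement` is the landed
`LightConeInLawSVC.ConeGlobal.sigma_eq_of_global_agreement`). No crux/stub statement is made.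
[cite: Spohn1991, Part I Ch. 3]
-/


namespace Summit.AtomisticToContinuum.HydrodynamicLimit.Theorems.LightConeInLawCSR

open scoped BigOperators Topology Classical ENNReal ProbabilityTheory
open Filter Set MeasureTheory ProbabilityTheory
open Literature.MathematicalPhysics.KineticTheory Literature.Analysis.FluidPDE
open Summit.AtomisticToContinuum.HydrodynamicLimit.Theorems.LightConeInLawSketch

noncomputable section

/-! ## Vocabulary of the line: ball counts and their law of large numbers -/

/-- **Ball count.** The number of particles of the configuration `z` whose position lies in the
open minimal-image ball `B(x₀, r) = {x | Torus.euclidDist x x₀ < r}` of the flat torus. The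
sufficient statistic of the line (together with the exterior configuration). -/
def ballCount {n : ℕ} (x₀ : T3) (r : ℝ) (z : Config n (Fin 3) T3) : ℕ :=
  (Finset.univ.filter fun i : Fin n => Torus.euclidDist (z i).1 x₀ < r).card

/-- The ball count is at most the particle number. -/
theorem ballCount_le {n : ℕ} (x₀ : T3) (r : ℝ) (z : Config n (Fin 3) T3) :
    ballCount x₀ r z ≤ n := by
  unfold ballCount
  exact (Finset.card_filter_le _ _).trans (by simp)

/-- The ball count as a real number is a finite sum of indicators. -/
theorem ballCount_cast_eq_sum {n : ℕ} (x₀ : T3) (r : ℝ) (z : Config n (Fin 3) T3) :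
    (ballCount x₀ r z : ℝ) = ∑ i : Fin n, if Torus.euclidDist (z i).1 x₀ < r then (1 : ℝ) else 0 := by
  unfold ballCount
  rw [Finset.card_filter, Nat.cast_sum]
  refine Finset.sum_congr rfl fun i _ => ?_
  split_ifs <;> simp

/-- The minimal-image distance of the `i`-th position to a fixed point is continuous. -/
theorem continuous_dist_coord {n : ℕ} (x₀ : T3) (i : Fin n) :
    Continuous fun z : Config n (Fin 3) T3 => Torus.euclidDist (z i).1 x₀ := by
  have h1 : Continuous fun z : Config n (Fin 3) T3 => (z i).1 :=
    continuous_fst.comp (continuous_apply i)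
  exact Torus.continuous_euclidDist.comp₂ h1 continuous_const

/-- The ball count, as a real number, is a measurable function of the configuration. -/
theorem measurable_ballCount_real {n : ℕ} (x₀ : T3) (r : ℝ) :
    Measurable fun z : Config n (Fin 3) T3 => (ballCount x₀ r z : ℝ) := by
  have heq : (fun z : Config n (Fin 3) T3 => (ballCount x₀ r z : ℝ)) =
      fun z => ∑ i : Fin n, if Torus.euclidDist (z i).1 x₀ < r then (1 : ℝ) else 0 :=
    funext fun z => ballCount_cast_eq_sum x₀ r z
  rw [heq]
  refine Finset.measurable_sum _ fun i _ => ?_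
  exact Measurable.ite (measurableSet_lt (continuous_dist_coord x₀ i).measurable measurable_const)
    measurable_const measurable_const

/-- The ball count is a measurable function of the configuration. -/
theorem measurable_ballCount : ∀ {n : ℕ} (x₀ : T3) (r : ℝ), Measurable (ballCount (n := n) x₀ r) := by
  intro n x₀ r
  refine measurable_to_countable' fun k => ?_
  have hset : ballCount (n := n) x₀ r ⁻¹' {k} =
      (fun z : Config n (Fin 3) T3 => (ballCount x₀ r z : ℝ)) ⁻¹' {(k : ℝ)} := by
    ext z
    simp only [Set.mem_preimage, Set.mem_singleton_iff, Nat.cast_inj]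
  rw [hset]
  exact measurable_ballCount_real x₀ r (measurableSet_singleton _)

/-- **Law of large numbers for a ball count** (normalised by `N + 1`, whatever the particle number
`n N` of the family): `ballCount x₀ r z / (N + 1) → m` in `P N`-probability. For the conjunct's gas
`m = ∫_{B(x₀,r)} ρ(0, x) dx`; for a comparison gas of `n₂ N` spheres with `n₂ N ε_N³ → σ₂³` whose
reduced density agrees with the conjunct's on the ball, the limit is the SAME `m`
(`n₂ N / (N+1) → (σ₂/σ₁)³` compensates the reduced-density factor). A predicate, never a fact. -/
def CountLLN (n : ℕ → ℕ) (P : (N : ℕ) → Measure (Config (n N) (Fin 3) T3)) (x₀ : T3)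
    (r m : ℝ) : Prop :=
  ∀ δ : ℝ, 0 < δ →
    Tendsto (fun N => P N {z | δ < |(ballCount x₀ r z : ℝ) / ((N : ℝ) + 1) - m|}) atTop (𝓝 0)

/-! ## The observable of the crux -/

/-- **The observable of the crux**: a bounded `1`-Lipschitz functional `F` of the REDUCED empirical
triple `(σ³ ρ_N(χ), σ³ • j_N(χ), σ³ e_N(χ))` of the configuration evolved to time `t` by the flow `Φ`
(the fields carry the own-particle-number normalisation of `empiricalMeasure`, the factor `σ³` makes
them the microscopic observable `ε_N³ Σ χ(xᵢ) (1, vᵢ, |vᵢ|²/2)` up to `1 + o(1)`). The crux's two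
integrands are `obsF (Φ₁ N) σ₁ t χ F` and `obsF (Φ₂ N) σ₂ t χ F` by `rfl`. -/
def obsF {n : ℕ} {ε : ℝ} (Φ : HardSphereFlow G3 ε n) (σ t : ℝ) (χ : T3 → ℝ)
    (F : ℝ × V3 × ℝ → ℝ) (z : Config n (Fin 3) T3) : ℝ :=
  F (σ ^ 3 * empiricalDensityField (Φ.flow t z) χ,
    (σ ^ 3) • empiricalMomentumField (Φ.flow t z) χ,
    σ ^ 3 * empiricalEnergyField (Φ.flow t z) χ)

/-- The observable is a measurable function of the initial configuration (continuous `χ`,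
Lipschitz `F`). -/
theorem measurable_obsF {n : ℕ} {ε : ℝ} (Φ : HardSphereFlow G3 ε n) (σ t : ℝ) {χ : T3 → ℝ}
    (hχ : Continuous χ) {F : ℝ × V3 × ℝ → ℝ} (hF : LipschitzWith 1 F) :
    Measurable (obsF Φ σ t χ F) :=
  hF.continuous.measurable.comp (TimeZero.measurable_reducedTriple Φ σ t hχ)

/-! ## Small tools for the composition -/

/-- **An `LLNAt` hypothesis forces unit mass of the target density** (test `χ ≡ 1`, whose
empirical density is identically `1` once there is at least one particle). Adapted from the
standing disprover's `Disproof.lean` §1 (`integral_density_eq_one_of_lln`) to general families. -/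
theorem integral_eq_one_of_llnAt : ∀ {n : ℕ → ℕ} {ε : ℕ → ℝ} {P : (N : ℕ) → Measure (Config (n N) (Fin 3) T3)}, (∀ N, IsProbabilityMeasure (P N)) → ∀ {Φ : (N : ℕ) → HardSphereFlow G3 (ε N) (n N)} {ρ Θ : T3 → ℝ} {U : T3 → V3} {t : ℝ}, (∀ᶠ N in atTop, n N ≠ 0) → LLNAt n P Φ ρ U Θ t → ∫ x, ρ x = 1 := by
  intro n ε P hP Φ ρ Θ U t hn h
  by_contra hne
  set I : ℝ := ∫ x, ρ x with hI
  have hk : 0 < |1 - I| := abs_pos.2 (sub_ne_zero.2 (Ne.symm hne))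
  have h1 := (h (fun _ => 1) continuous_const (|1 - I| / 2) (by positivity)).1
  have hint : ∫ x : T3, (fun _ : T3 => (1 : ℝ)) x * ρ x = I := by simp [hI]
  have hev : ∀ᶠ N in atTop, P N {z | |1 - I| / 2 <
      |empiricalDensityField ((Φ N).flow t z) (fun _ => (1 : ℝ)) -
        ∫ x : T3, (fun _ : T3 => (1 : ℝ)) x * ρ x|} = 1 := by
    filter_upwards [hn] with N hN
    have huniv : {z : Config (n N) (Fin 3) T3 | |1 - I| / 2 <
        |empiricalDensityField ((Φ N).flow t z) (fun _ => (1 : ℝ)) -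
          ∫ x : T3, (fun _ : T3 => (1 : ℝ)) x * ρ x|} = Set.univ := by
      refine Set.eq_univ_of_forall fun z => ?_
      rw [Set.mem_setOf_eq, hint, empiricalDensityField_one hN]
      linarith [le_abs_self (1 - I), neg_abs_le (1 - I), abs_nonneg (1 - I)]
    haveI := hP N
    rw [huniv, measure_univ]
  have h2 : Tendsto (fun _ : ℕ => (1 : ℝ≥0∞)) atTop (𝓝 0) := (tendsto_congr' hev).1 h1
  exact one_ne_zero (tendsto_const_nhds_iff.1 h2)

/-- **A canonical kernel does not see a constant factor of the one-body weight** (it cancels against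
the partition function; if the latter vanishes both sides are the junk `0`). This is the static half
of the card's sufficiency lever: gauge-equivalent activities give the same canonical law. -/
theorem canonicalDensity_const_mul {n : ℕ} {lam : ℝ} (hlam : lam ≠ 0) (ε : ℝ) (f : T3 × V3 → ℝ) :
    canonicalDensity G3 ε n (fun y => lam * f y) = canonicalDensity G3 ε n f := by
  funext z
  set D := hardSphereDomain G3 n ε with hD
  have htp : tensorPow n (fun y => lam * f y) =
      fun z : Config n (Fin 3) T3 => lam ^ n * tensorPow n f z := by
    funext w
    simp [tensorPow, Finset.prod_mul_distrib, Finset.prod_const]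
  have hind : D.indicator (tensorPow n (fun y => lam * f y)) =
      fun z => lam ^ n * D.indicator (tensorPow n f) z := by
    funext w
    rw [htp]
    by_cases hw : w ∈ D <;> simp [hw]
  have hZ : canonicalPartition G3 ε n (fun y => lam * f y) = lam ^ n * canonicalPartition G3 ε n f := by
    simp only [canonicalPartition, ← hD, hind]
    exact integral_const_mul _ _
  have han : (lam ^ n)⁻¹ * lam ^ n = 1 := inv_mul_cancel₀ (pow_ne_zero n hlam)
  simp only [canonicalDensity, ← hD, hZ, hind]
  calc (lam ^ n * canonicalPartition G3 ε n f)⁻¹ * (lam ^ n * D.indicator (tensorPow n f) z)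
      = ((lam ^ n)⁻¹ * lam ^ n) * ((canonicalPartition G3 ε n f)⁻¹ *
          D.indicator (tensorPow n f) z) := by rw [mul_inv]; ring
    _ = _ := by rw [han, one_mul]

end

end Summit.AtomisticToContinuum.HydrodynamicLimit.Theorems.LightConeInLawCSR
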